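import Literature.MathematicalPhysics.QuantumLattice.DWaveSourceWindowCertificate
import Literature.MathematicalPhysics.QuantumLattice.HubbardWindowCertificateD4
import HarnessLib

/-!
# Window certificates for the pair-sourced Hubbard model with POINT-GROUP reductions

Family `hubbard` (topic `MathematicalPhysics/QuantumLattice`). Companion of
`DWaveSourceWindowCertificate`: there the symmetry identifications of a thermodynamic-limit window
(bootstrap / sum-of-squares) certificate for the d-wave pair-sourced grand-canonical Hubbard model
`A_L = H_L(1,U) − μ N_L − h (Δ_L + Δ_Lᴴ)` (`dWaveSourceTorus L U μ h`) were lattice TRANSLATIONS.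
The `d_{x²−y²}` pair field transforms under the point group `D₄` of the square lattice by the
character `χ_{B₁g}` (`relabel_d4Perm_pairField_dWave`), so `A_L` is invariant exactly under the
affine maps `x ↦ γ·x + w` with `χ_{B₁g}(γ) = 1` — `γ ∈ {1, r², s, s r²}`: the identity, the rotation
by `π` and the two axis reflections (`d4Affine_mul_dWaveSourceTorus`). Here the window certificate
theorem is restated with this larger symmetry family (Han 2020 §3, constraints `F[U⁻¹ O U] = F[O]`),
realised on the window by `PolySite.d4Emb γ w Λ : Λ ↪ γΛ + w` and on every torus by `U_{w mod L} D_γ`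
(tree `HubbardWindowCertificateD4`: `fermionEmbed_toTorusEmb_d4_sub`, `d4Affine_conjTranspose_mul_self`):
`dWaveSourceTorus_groundEnergy_ge_of_window_certificate_d4` and its eventual (all large `L`) corollary,
the `hlo` input of the `Summit.HubbardSuperconductivity.HubbardLadder` energy-response certificates.
Rows with `χ_{B₁g}(γ) = −1` (the rotation by `π/2`, the diagonal reflections) are NOT admissible: they
map the source `h` to `−h`. Everything here is PROVED; there are no new definitions.

## References
* X. Han, *Quantum many-body bootstrap*, arXiv:2006.06002 (2020), §3 (symmetry constraints
  `T_(1,0), T_(0,1), Π, R`; stationarity; positivity). [cite: Han2020Bootstrap, §3]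
* D. J. Scalapino, Phys. Rep. 250 (1995) 329, §2 (point group `C₄ᵥ ≅ D₄` of the square lattice and
  the `B₁g` = `d_{x²−y²}` channel). [cite: Scalapino1995, §2]
* O. Bratteli, D. W. Robinson, *Operator Algebras and Quantum Statistical Mechanics II*, 2nd ed.,
  §6.2.4 (periodic boxes and the thermodynamic limit of lattice fermions). [cite: BratteliRobinsonII1997, §6.2.4]
-/

noncomputable section

namespace Literature.MathematicalPhysics.QuantumLattice

open Matrix Finset HubbardWave0 Literature.Probability.LatticeModels
open Literature.MathematicalPhysics.QuantumManyBody.StateRelaxation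
open scoped ComplexOrder BigOperators

/-! ### The admissible point-group maps commute with the sourced Hamiltonian -/

section Torus

variable (L : ℕ) [NeZero L]

/-- **The affine `D₄` maps in the kernel of `χ_{B₁g}` commute with the pair-sourced torus
Hamiltonian**: for `γ ∈ D₄` with `χ_{B₁g}(γ) = 1` (identity, rotation by `π`, the two axis
reflections) and every torus vector `w`, `U_w D_γ A_L = A_L U_w D_γ` — since
`D_γ H_L(1,U,μ) D_γᴴ = H_L(1,U,μ)` and `D_γ Δ_L D_γᴴ = χ_{B₁g}(γ) Δ_L`. [cite: Scalapino1995, §2] -/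
theorem d4Affine_mul_dWaveSourceTorus (γ : DihedralGroup 4) (hγ : b1gChar γ = 1) (w : TorusSite 2 L)
    (U μ h : ℝ) :
    (fockTranslate w).val * (fockD4 (L := L) γ).val * dWaveSourceTorus L U μ h =
      dWaveSourceTorus L U μ h * ((fockTranslate w).val * (fockD4 (L := L) γ).val) := by
  have hD : (fockD4 (L := L) γ).val * dWaveSourceTorus L U μ h =
      dWaveSourceTorus L U μ h * (fockD4 (L := L) γ).val := by
    refine (fockRelabel_commute_of_relabel_eq _ ?_).eq
    rw [dWaveSourceTorus, relabel_sub, relabel_smul, relabel_add, relabel_conjTranspose,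
      relabel_d4Perm_hubbardTorusWith, relabel_d4Perm_pairField_dWave, hγ, one_smul]
  rw [Matrix.mul_assoc, hD, ← Matrix.mul_assoc, fockTranslate_mul_dWaveSourceTorus, Matrix.mul_assoc]

end Torus

/-! ### The window certificate theorem with point-group reductions -/

section Certificate

variable {L : ℕ} [NeZero L]

/-- (Local to this section, as in `DWaveSourceWindowCertificate`.) [folklore] -/
local instance (priority := high) instDecidableEqFermionTorusSrcWindowD4 : DecidableEq (FermionTorus 2 L) :=
  LinearOrder.toDecidableEq

/-- **Window certificate with affine `D₄` reductions ⇒ ground-state energy of EVERY large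
pair-sourced Hubbard torus.** As `dWaveSourceTorus_groundEnergy_ge_of_window_certificate`, with the
symmetry family of AFFINE maps `x ↦ γₗ·x + vₗ` of `ℤ²` restricted to `χ_{B₁g}(γₗ) = 1` (translations:
`γₗ = 1`): the identity in `𝔄_{Λ'}`
`E^src − c·1 = Σ Λₐᵦ Oₐᴴ O_b + (Σₖ (H^src_{Λ'} Γ(incl)Bₖ − Γ(incl)Bₖ H^src_{Λ'})
   + Σₗ (Γ(incl)(Γ(d4Emb γₗ vₗ) Yₗ) − Γ(incl) Yₗ) + Σⱼ bⱼ • wⱼ) + (Σₘ dₘ • (Vₘᴴ − Vₘ) + Σₖ aₖ • vₖ)`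
(`Λ ⪰ 0`; `Bₖ, Yₗ ∈ 𝔄_Λ` with `γₗΛ + vₗ ⊆ Λ'`; `S^z`-charged ladder words `wⱼ`; real `dₘ`; ladder words
`vₖ`) proves `(c − Σₖ ‖aₖ‖) · L² ≤ E₀(dWaveSourceTorus L U μ h)` for every `L ≥ 3` with `x ↦ x mod L`
injective on `thicken Λ' 1`. Han 2020 §3 (`F[U⁻¹ O U] = F[O]` for the lattice symmetries `U`),
Scalapino 1995 §2 (the `B₁g` channel). [cite: Han2020Bootstrap, §3] -/
theorem dWaveSourceTorus_groundEnergy_ge_of_window_certificate_d4 (U μ h : ℝ) (hL : 3 ≤ L)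
    {Λ Λ' : Finset (Site 2)} (hΛ : Λ ⊆ Λ')
    (hclosed : ∀ x ∈ Λ, ∀ i : Fin 2, x + unitVec i ∈ Λ' ∧ x - unitVec i ∈ Λ')
    (h0 : thicken ({0} : Finset (Site 2)) 1 ⊆ Λ') (hz : (0 : Site 2) ∈ Λ')
    (hP : pairRegion (insert (0 : Site 2) unitSteps) 0 ⊆ Λ')
    (hInj : Set.InjOn (Torus.proj (d := 2) L) ↑(thicken Λ' 1))
    {m : Type*} [Fintype m] [DecidableEq m] {Λm : Matrix m m ℂ} (hΛm : Λm.PosSemidef)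
    (O : m → FermionOp Λ')
    {κ : Type*} (s : Finset κ) (B : κ → FermionOp Λ)
    {ι : Type*} (tt : Finset ι) (gam : ι → DihedralGroup 4) (v : ι → Site 2)
    (hgam : ∀ l ∈ tt, b1gChar (gam l) = 1) (hsh : ∀ l, d4ShiftSet (gam l) (v l) Λ ⊆ Λ') (Y : ι → FermionOp Λ)
    {χ : Type*} (u : Finset χ) (b : χ → ℂ) (cw : χ → List (Orb (PolySite Λ') × Bool))
    (hcw : ∀ j ∈ u, ladderSpinCharge (cw j) ≠ 0)
    {δ : Type*} (ah : Finset δ) (dc : δ → ℝ) (V : δ → FermionOp Λ')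
    {κ'' : Type*} (w : Finset κ'') (a : κ'' → ℂ) (word : κ'' → List (Orb (PolySite Λ') × Bool)) {c : ℝ}
    (hcert : fermionEmbed (PolySite.incl h0) ((hubbardFermionInteraction 2 1 U).meanEnergyObs 1) -
          (μ : ℂ) • ∑ σ : Fin 2, nAt 0 hz σ -
          (h : ℂ) • (fermionEmbed (PolySite.incl hP) (localPairAt (insert (0 : Site 2) unitSteps) dWaveFormFactor 0) +
            (fermionEmbed (PolySite.incl hP) (localPairAt (insert (0 : Site 2) unitSteps) dWaveFormFactor 0))ᴴ) -
        (c : ℂ) • (1 : FermionOp Λ') =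
      gramForm Λm O +
        (∑ k ∈ s, (pairSourceWindowHamiltonian dWaveFormFactor Λ' U μ h * fermionEmbed (PolySite.incl hΛ) (B k) -
            fermionEmbed (PolySite.incl hΛ) (B k) * pairSourceWindowHamiltonian dWaveFormFactor Λ' U μ h) +
          ∑ l ∈ tt, (fermionEmbed (PolySite.incl (hsh l)) (fermionEmbed (PolySite.d4Emb (gam l) (v l) Λ) (Y l)) -
            fermionEmbed (PolySite.incl hΛ) (Y l)) +
          ∑ j ∈ u, b j • ladderWord (cw j)) +
        (∑ m' ∈ ah, ((dc m' : ℝ) : ℂ) • ((V m')ᴴ - V m') + ∑ k ∈ w, a k • ladderWord (word k))) :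
    (c - ∑ k ∈ w, ‖a k‖) * (L : ℝ) ^ 2 ≤ (dWaveSourceTorus L U μ h).groundEnergy := by
  classical
  -- the pull-back homomorphism and its restriction to the inner region
  have hInj' : Set.InjOn (Torus.proj (d := 2) L) ↑Λ' := hInj.mono (by exact_mod_cast subset_thicken Λ' 1)
  have hInjΛ : Set.InjOn (Torus.proj (d := 2) L) ↑Λ := hInj'.mono (by exact_mod_cast hΛ)
  set Γ' := fermionEmbed (PolySite.toTorusEmb L hInj') with hΓ'
  set ΓΛ := fermionEmbed (PolySite.toTorusEmb L hInjΛ) with hΓΛ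
  set H := dWaveSourceTorus L U μ h with hH
  have hHh : H.IsHermitian :=
    dWaveSourceTorus_isHermitian L (hubbardTorusWith_isHermitian (hamiltonianWith_isHermitian_and_commute_holds _) 1 U μ) h
  -- the objective; its torus translates sum to `A_L`
  set X := Γ' (fermionEmbed (PolySite.incl h0) ((hubbardFermionInteraction 2 1 U).meanEnergyObs 1) -
      (μ : ℂ) • ∑ σ : Fin 2, nAt 0 hz σ -
      (h : ℂ) • (fermionEmbed (PolySite.incl hP) (localPairAt (insert (0 : Site 2) unitSteps) dWaveFormFactor 0) +
        (fermionEmbed (PolySite.incl hP) (localPairAt (insert (0 : Site 2) unitSteps) dWaveFormFactor 0))ᴴ)) with hX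
  set T : TorusSite 2 L → Matrix (Finset (Orb (FermionTorus 2 L))) (Finset (Orb (FermionTorus 2 L))) ℂ :=
    fun v' => (fockTranslate v').val with hT
  have hTH : ∀ v', T v' * H = H * T v' := fun v' => fockTranslate_mul_dWaveSourceTorus L v' U μ h
  have hTT : ∀ v', (T v')ᴴ * T v' = 1 := fun v' => fockTranslate_conjTranspose_mul_self v'
  have hsum : ∑ v', T v' * X * (T v')ᴴ = H := by
    rw [hH, dWaveSourceTorus, hX, hΓ']
    exact sum_conj_fockTranslate_pairSourceObjective dWaveFormFactor L h0 hz hP hInj' hL U μ h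
  -- the sector is the whole Fock space
  have hK : (⊤ : Submodule ℂ (Fock (Orb (FermionTorus 2 L)))) ≠ ⊥ := top_ne_bot
  -- symmetry family: affine `D₄` maps `x ↦ γₗ x + vₗ` with `χ_{B₁g}(γₗ) = 1`
  set Us : ι → Matrix (Finset (Orb (FermionTorus 2 L))) (Finset (Orb (FermionTorus 2 L))) ℂ :=
    fun l => (fockTranslate (Torus.proj L (v l))).val * (fockD4 (L := L) (gam l)).val with hUs
  set Yt : ι → Matrix (Finset (Orb (FermionTorus 2 L))) (Finset (Orb (FermionTorus 2 L))) ℂ :=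
    fun l => ΓΛ (Y l) with hYt
  have hU : ∀ l ∈ tt, Us l * H = H * Us l := fun l hl =>
    d4Affine_mul_dWaveSourceTorus L (gam l) (hgam l hl) _ U μ h
  have hUU : ∀ l ∈ tt, (Us l)ᴴ * Us l = 1 := fun l _ => d4Affine_conjTranspose_mul_self _ _
  -- charge family: `S^z`-charged words are commutators with the conserved `S^z`
  set emb : Orb (PolySite Λ') × Bool → Orb (FermionTorus 2 L) × Bool :=
    fun p => (Orb.embMap (PolySite.toTorusEmb L hInj') p.1, p.2) with hemb
  set C : χ → Matrix (Finset (Orb (FermionTorus 2 L))) (Finset (Orb (FermionTorus 2 L))) ℂ :=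
    fun _ => HubbardWave0.spinZ with hC
  set W : χ → Matrix (Finset (Orb (FermionTorus 2 L))) (Finset (Orb (FermionTorus 2 L))) ℂ :=
    fun j => (b j / (((ladderSpinCharge ((cw j).map emb) : ℤ) : ℂ) / 2)) • ladderWord ((cw j).map emb) with hW
  have hC1 : ∀ j ∈ u, C j * H = H * C j := fun _ _ => spinZ_mul_dWaveSourceTorus L U μ h
  have hcharged : ∀ j ∈ u, Γ' (b j • ladderWord (cw j)) = C j * W j - W j * C j := by
    intro j hj
    have hq : (((ladderSpinCharge ((cw j).map emb) : ℤ) : ℂ) / 2) ≠ 0 := by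
      rw [hemb, ladderSpinCharge_map_embMap]
      exact div_ne_zero (Int.cast_ne_zero.2 (hcw j hj)) two_ne_zero
    rw [fermionEmbed_smul, fermionEmbed_ladderWord, hC, hW]
    simp only [Matrix.mul_smul, Matrix.smul_mul]
    rw [← smul_sub, spinZ_comm_ladderWord, smul_smul, div_mul_cancel₀ _ hq]
  -- residual words are contractions
  set M : κ'' → Matrix (Finset (Orb (FermionTorus 2 L))) (Finset (Orb (FermionTorus 2 L))) ℂ :=
    fun k => ladderWord ((word k).map emb) with hM
  have hMc : ∀ k ∈ w, (M k).IsContraction := fun k _ => by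
    rw [hM]; dsimp only; rw [ladderWord_eq_prod]; exact isContraction_prod_ladder _
  -- the identity, pulled back into the torus
  have htorus : X - (c : ℂ) • (1 : Matrix (Finset (Orb (FermionTorus 2 L))) (Finset (Orb (FermionTorus 2 L))) ℂ) =
      gramForm Λm (fun i => Γ' (O i)) +
        (∑ k ∈ s, (H * Γ' (fermionEmbed (PolySite.incl hΛ) (B k)) - Γ' (fermionEmbed (PolySite.incl hΛ) (B k)) * H) +
          ∑ l ∈ tt, (Us l * Yt l * (Us l)ᴴ - Yt l) +
          ∑ i ∈ (∅ : Finset (Fin 0)), ((0 : Matrix _ _ ℂ) * ((0 : Matrix _ _ ℂ) - (((0 : ℝ) : ℝ) : ℂ) • 1) +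
            ((0 : Matrix _ _ ℂ) - (((0 : ℝ) : ℝ) : ℂ) • 1) * (0 : Matrix _ _ ℂ)) +
          ∑ j ∈ u, (C j * W j - W j * C j)) +
        (∑ m' ∈ ah, ((dc m' : ℝ) : ℂ) • ((Γ' (V m'))ᴴ - Γ' (V m')) + ∑ k ∈ w, a k • M k) := by
    have key := congrArg Γ' hcert
    rw [fermionEmbed_sub, fermionEmbed_smul, fermionEmbed_one] at key
    have h1 : Γ' (∑ k ∈ s, (pairSourceWindowHamiltonian dWaveFormFactor Λ' U μ h * fermionEmbed (PolySite.incl hΛ) (B k) -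
        fermionEmbed (PolySite.incl hΛ) (B k) * pairSourceWindowHamiltonian dWaveFormFactor Λ' U μ h)) =
        ∑ k ∈ s, (H * Γ' (fermionEmbed (PolySite.incl hΛ) (B k)) - Γ' (fermionEmbed (PolySite.incl hΛ) (B k)) * H) := by
      rw [fermionEmbed_sum]
      refine Finset.sum_congr rfl fun k _ => ?_
      rw [hH, hΓ', dWaveSourceTorus_commutator_fermionEmbed L hΛ hclosed hInj U μ h (B k)]
    have h2 : Γ' (∑ l ∈ tt, (fermionEmbed (PolySite.incl (hsh l)) (fermionEmbed (PolySite.d4Emb (gam l) (v l) Λ) (Y l)) -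
        fermionEmbed (PolySite.incl hΛ) (Y l))) = ∑ l ∈ tt, (Us l * Yt l * (Us l)ᴴ - Yt l) := by
      rw [fermionEmbed_sum]
      refine Finset.sum_congr rfl fun l _ => ?_
      rw [hUs, hYt, hΓΛ]
      exact fermionEmbed_toTorusEmb_d4_sub hΛ (gam l) (v l) (hsh l) hInj' (Y l)
    have h3 : Γ' (∑ j ∈ u, b j • ladderWord (cw j)) = ∑ j ∈ u, (C j * W j - W j * C j) := by
      rw [fermionEmbed_sum]
      exact Finset.sum_congr rfl hcharged
    have h4 : Γ' (∑ m' ∈ ah, ((dc m' : ℝ) : ℂ) • ((V m')ᴴ - V m')) =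
        ∑ m' ∈ ah, ((dc m' : ℝ) : ℂ) • ((Γ' (V m'))ᴴ - Γ' (V m')) := by
      rw [fermionEmbed_sum]
      refine Finset.sum_congr rfl fun m' _ => ?_
      rw [fermionEmbed_smul, fermionEmbed_sub, hΓ', fermionEmbed_conjTranspose]
    have h5 : Γ' (∑ k ∈ w, a k • ladderWord (word k)) = ∑ k ∈ w, a k • M k := by
      rw [fermionEmbed_sum]
      refine Finset.sum_congr rfl fun k _ => ?_
      rw [fermionEmbed_smul, hM, fermionEmbed_ladderWord]
    rw [hX, key, fermionEmbed_add, fermionEmbed_add, fermionEmbed_add, fermionEmbed_add, fermionEmbed_add, hΓ',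
      fermionEmbed_gramForm, ← hΓ', h1, h2, h3, h4, h5, Finset.sum_empty, add_zero]
  -- the symmetric local-certificate theorem on the whole Fock space
  have hmain := Matrix.mul_card_le_minEnergyOn_of_local_certificate hHh ⊤ (fun _ _ => Submodule.mem_top) hK
    X T hTH (fun _ _ _ => Submodule.mem_top) (fun _ _ _ => Submodule.mem_top) hTT hsum hΛm
    (fun i => Γ' (O i)) s (fun k => Γ' (fermionEmbed (PolySite.incl hΛ) (B k))) tt Us Yt hU
    (fun _ _ _ _ => Submodule.mem_top) (fun _ _ _ _ => Submodule.mem_top) hUU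
    (∅ : Finset (Fin 0)) (fun _ => 0) (fun _ => 0) (fun _ => 0) (fun _ => 0)
    (fun i hi => absurd hi (Finset.notMem_empty i)) (fun i hi => absurd hi (Finset.notMem_empty i))
    u C W hC1 (fun _ _ _ _ => Submodule.mem_top) (fun _ _ _ _ => Submodule.mem_top)
    ah dc (fun m' => Γ' (V m')) w a M hMc htorus
  rw [card_torusSite, Matrix.minEnergyOn_top_holds hHh] at hmain
  exact_mod_cast hmain

end Certificate

/-- **Eventual form, in the shape of the certificate consumers** (`PairSourceEnergyCertAlong.ofEnergyRows`,
input `hlo`): with the (L-independent) data of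
`dWaveSourceTorus_groundEnergy_ge_of_window_certificate_d4` there is `L₀` with
`(c − Σₖ ‖aₖ‖) · L² ≤ E₀(dWaveSourceTorus L U μ h)` for every `L ≥ L₀`, stated with the library
instances found at the concrete torus. [cite: Han2020Bootstrap, §3] -/
theorem dWaveSourceTorus_groundEnergy_ge_of_window_certificate_d4_eventually (U μ h : ℝ)
    {Λ Λ' : Finset (Site 2)} (hΛ : Λ ⊆ Λ')
    (hclosed : ∀ x ∈ Λ, ∀ i : Fin 2, x + unitVec i ∈ Λ' ∧ x - unitVec i ∈ Λ')
    (h0 : thicken ({0} : Finset (Site 2)) 1 ⊆ Λ') (hz : (0 : Site 2) ∈ Λ')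
    (hP : pairRegion (insert (0 : Site 2) unitSteps) 0 ⊆ Λ')
    {m : Type*} [Fintype m] [DecidableEq m] {Λm : Matrix m m ℂ} (hΛm : Λm.PosSemidef)
    (O : m → FermionOp Λ')
    {κ : Type*} (s : Finset κ) (B : κ → FermionOp Λ)
    {ι : Type*} (tt : Finset ι) (gam : ι → DihedralGroup 4) (v : ι → Site 2)
    (hgam : ∀ l ∈ tt, b1gChar (gam l) = 1) (hsh : ∀ l, d4ShiftSet (gam l) (v l) Λ ⊆ Λ') (Y : ι → FermionOp Λ)
    {χ : Type*} (u : Finset χ) (b : χ → ℂ) (cw : χ → List (Orb (PolySite Λ') × Bool))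
    (hcw : ∀ j ∈ u, ladderSpinCharge (cw j) ≠ 0)
    {δ : Type*} (ah : Finset δ) (dc : δ → ℝ) (V : δ → FermionOp Λ')
    {κ'' : Type*} (w : Finset κ'') (a : κ'' → ℂ) (word : κ'' → List (Orb (PolySite Λ') × Bool)) {c : ℝ}
    (hcert : fermionEmbed (PolySite.incl h0) ((hubbardFermionInteraction 2 1 U).meanEnergyObs 1) -
          (μ : ℂ) • ∑ σ : Fin 2, nAt 0 hz σ -
          (h : ℂ) • (fermionEmbed (PolySite.incl hP) (localPairAt (insert (0 : Site 2) unitSteps) dWaveFormFactor 0) +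
            (fermionEmbed (PolySite.incl hP) (localPairAt (insert (0 : Site 2) unitSteps) dWaveFormFactor 0))ᴴ) -
        (c : ℂ) • (1 : FermionOp Λ') =
      gramForm Λm O +
        (∑ k ∈ s, (pairSourceWindowHamiltonian dWaveFormFactor Λ' U μ h * fermionEmbed (PolySite.incl hΛ) (B k) -
            fermionEmbed (PolySite.incl hΛ) (B k) * pairSourceWindowHamiltonian dWaveFormFactor Λ' U μ h) +
          ∑ l ∈ tt, (fermionEmbed (PolySite.incl (hsh l)) (fermionEmbed (PolySite.d4Emb (gam l) (v l) Λ) (Y l)) -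
            fermionEmbed (PolySite.incl hΛ) (Y l)) +
          ∑ j ∈ u, b j • ladderWord (cw j)) +
        (∑ m' ∈ ah, ((dc m' : ℝ) : ℂ) • ((V m')ᴴ - V m') + ∑ k ∈ w, a k • ladderWord (word k))) :
    ∃ L₀ : ℕ, ∀ (L : ℕ) [NeZero L], L₀ ≤ L →
      (c - ∑ k ∈ w, ‖a k‖) * (L : ℝ) ^ 2 ≤ (dWaveSourceTorus L U μ h).groundEnergy := by
  obtain ⟨L₁, hL₁⟩ := exists_forall_le_injOn_proj (thicken Λ' 1)
  refine ⟨max 3 L₁, fun L _ hL => ?_⟩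
  -- the two `DecidableEq (FermionTorus 2 L)` instances agree by `Subsingleton.elim`
  convert dWaveSourceTorus_groundEnergy_ge_of_window_certificate_d4 U μ h (le_trans (le_max_left _ _) hL) hΛ
    hclosed h0 hz hP (hL₁ L (le_trans (le_max_right _ _) hL)) hΛm O s B tt gam v hgam hsh Y u b cw hcw ah dc
    V w a word hcert using 2

end Literature.MathematicalPhysics.QuantumLattice
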